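import Summits.Langlands.Langlands.Theorems.SqrtFiveQuarticCoversE7DescentWLocal

/-!
# Route `Langlands/SqrtFiveQuarticCovers`, sheet 4.5 row 8 — 2-descent for `W⁵ = 1225.c1`: LOCAL part

`W⁵ : y² = x(x² + 1470x − 8575)` (the quadratic twist of `W = 49a4` by `5`; minimal model
`[1,−1,1,−45555,3753572]` = LMFDB `1225.c1`) and its 2-isogenous curve
`W⁵' : Y² = X(X² − 2940X + 2195200)` (minimal model `[1,−1,1,−2680,66322]` = LMFDB `1225.c2`).
LOCAL half of the complete 2-isogeny descent (eng-8 g3, E7-MW-FERMAT):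

* §1 empty classes: on `W⁵` (`b = −8575 = −5²7³`, squarefree classes `±{1,5,7,35}`) the classes
  `−1, 7, −5, 35` die mod `16` and `5, −35` die 5-adically (`5 ∣ N`, then mod `5`); on `W⁵'`
  (`b' = 2195200 = 2⁸5²7³`) the classes `5, 10, 35, 70` die 5-adically, `2, 14` die 2-adically at
  depth `2⁸` (parity chains as for `W'`), negative classes die at `ℝ`.
* §2 NORMALISATION: `W5_sq_or_transl_sq` (`x = r²` or `−8575/x = r²`) and `W5p_sq_or_transl_sq`
  (`X = R²` or `2195200/X = R²`).

HONEST STATUS: kernel arithmetic about two explicit curves over `ℚ`; no named input; not a modularity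
statement.  References: Silverman–Tate III.4–5; LMFDB `1225.c`; kit j319940, j320107, j320342.
-/

set_option linter.dupNamespace false -- project-wide option; `Summit.Langlands.Langlands` is the mandated namespace

namespace Summit.Langlands.Langlands.Theorems.SqrtFiveQuarticCovers

/-! ### §1 Local certificates -/

section Kills

/-- Generic mod-16 kill: if the quartic forces `M`, `e` even mod 16, there is no coprime solution.
[folklore] -/
theorem kill_mod16 {d c : ℤ}
    (key : ∀ m f n : ZMod 16, n ^ 2 = (d : ZMod 16) * m ^ 4 + 1470 * m ^ 2 * f ^ 2 + (c : ZMod 16) * f ^ 4 →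
      (8 : ZMod 16) * m = 0 ∧ (8 : ZMod 16) * f = 0)
    {M e N : ℤ} (hcop : Int.gcd M e = 1)
    (h : N ^ 2 = d * M ^ 4 + 1470 * M ^ 2 * e ^ 2 + c * e ^ 4) : False := by
  have hc := intCast_sq_eq (m := 16) h
  push_cast at hc
  obtain ⟨hM, hE⟩ := key _ _ _ hc
  exact false_of_dvd_of_dvd_of_gcd_eq_one (d := 2) (by norm_num) (two_dvd_of_zmod16 hM)
    (two_dvd_of_zmod16 hE) hcop

/-- `W⁵`, classes `−1, 7, −5, 35` are empty (mod `16`). [folklore] -/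
theorem W5_kill_mod16 {d c : ℤ}
    (hdc : (d = -1 ∧ c = 8575) ∨ (d = 7 ∧ c = -1225) ∨ (d = -5 ∧ c = 1715) ∨ (d = 35 ∧ c = -245))
    {M e N : ℤ} (hcop : Int.gcd M e = 1)
    (h : N ^ 2 = d * M ^ 4 + 1470 * M ^ 2 * e ^ 2 + c * e ^ 4) : False := by
  rcases hdc with ⟨rfl, rfl⟩ | ⟨rfl, rfl⟩ | ⟨rfl, rfl⟩ | ⟨rfl, rfl⟩
  · exact kill_mod16 (by decide) hcop h
  · exact kill_mod16 (by decide) hcop h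
  · exact kill_mod16 (by decide) hcop h
  · exact kill_mod16 (by decide) hcop h

/-- Generic 5-adic kill for a quartic `N² = 5·G(M, e)` whose reduction `G mod 5 = 0` forces
`M ≡ e ≡ 0`. [folklore] -/
theorem kill_five {g₄ g₂ g₀ : ℤ}
    (key : ∀ m f : ZMod 5, (g₄ : ZMod 5) * m ^ 4 + (g₂ : ZMod 5) * m ^ 2 * f ^ 2 + (g₀ : ZMod 5) * f ^ 4 = 0 →
      m = 0 ∧ f = 0)
    {M e N : ℤ} (hcop : Int.gcd M e = 1)
    (h : N ^ 2 = 5 * (g₄ * M ^ 4 + g₂ * M ^ 2 * e ^ 2 + g₀ * e ^ 4)) : False := by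
  have h5N : (5 : ℤ) ∣ N := by
    have : (5 : ℤ) ∣ N ^ 2 := ⟨_, h⟩
    exact Int.Prime.dvd_pow' (by norm_num) this
  obtain ⟨N₁, rfl⟩ := h5N
  have hG : (5 : ℤ) ∣ g₄ * M ^ 4 + g₂ * M ^ 2 * e ^ 2 + g₀ * e ^ 4 := by
    refine ⟨N₁ ^ 2, mul_left_cancel₀ (by norm_num : (5 : ℤ) ≠ 0) ?_⟩
    linear_combination -h
  have hc : (g₄ : ZMod 5) * (M : ZMod 5) ^ 4 + (g₂ : ZMod 5) * (M : ZMod 5) ^ 2 * (e : ZMod 5) ^ 2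
      + (g₀ : ZMod 5) * (e : ZMod 5) ^ 4 = 0 := by
    have := (ZMod.intCast_zmod_eq_zero_iff_dvd _ 5).mpr hG
    push_cast at this
    exact this
  obtain ⟨hM, hE⟩ := key _ _ hc
  exact false_of_dvd_of_dvd_of_gcd_eq_one (d := 5) (by norm_num)
    ((ZMod.intCast_zmod_eq_zero_iff_dvd M 5).mp hM) ((ZMod.intCast_zmod_eq_zero_iff_dvd e 5).mp hE) hcop

/-- `W⁵`, class `5` is empty: `N² = 5M⁴ + 1470M²e² − 1715e⁴` (5-adic). [folklore] -/
theorem W5_kill_5 {M e N : ℤ} (hcop : Int.gcd M e = 1)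
    (h : N ^ 2 = 5 * M ^ 4 + 1470 * M ^ 2 * e ^ 2 - 1715 * e ^ 4) : False :=
  kill_five (g₄ := 1) (g₂ := 294) (g₀ := -343) (by decide) (N := N) hcop (by linear_combination h)

/-- `W⁵`, class `−35` is empty: `N² = −35M⁴ + 1470M²e² + 245e⁴` (5-adic). [folklore] -/
theorem W5_kill_neg35 {M e N : ℤ} (hcop : Int.gcd M e = 1)
    (h : N ^ 2 = -35 * M ^ 4 + 1470 * M ^ 2 * e ^ 2 + 245 * e ^ 4) : False :=
  kill_five (g₄ := -7) (g₂ := 294) (g₀ := 49) (by decide) (N := N) hcop (by linear_combination h)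

/-- `W⁵'`, classes `5, 10, 35, 70` are empty (5-adic): `N² = d₀M⁴ − 2940M²e² + (2195200/d₀)e⁴`.
[folklore] -/
theorem W5p_kill_five {d c : ℤ}
    (hdc : (d = 5 ∧ c = 439040) ∨ (d = 10 ∧ c = 219520) ∨ (d = 35 ∧ c = 62720) ∨ (d = 70 ∧ c = 31360))
    {M e N : ℤ} (hcop : Int.gcd M e = 1)
    (h : N ^ 2 = d * M ^ 4 - 2940 * M ^ 2 * e ^ 2 + c * e ^ 4) : False := by
  rcases hdc with ⟨rfl, rfl⟩ | ⟨rfl, rfl⟩ | ⟨rfl, rfl⟩ | ⟨rfl, rfl⟩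
  · exact kill_five (g₄ := 1) (g₂ := -588) (g₀ := 87808) (by decide) (N := N) hcop (by linear_combination h)
  · exact kill_five (g₄ := 2) (g₂ := -588) (g₀ := 43904) (by decide) (N := N) hcop (by linear_combination h)
  · exact kill_five (g₄ := 7) (g₂ := -588) (g₀ := 12544) (by decide) (N := N) hcop (by linear_combination h)
  · exact kill_five (g₄ := 14) (g₂ := -588) (g₀ := 6272) (by decide) (N := N) hcop (by linear_combination h)

/-- **`W⁵'`, class `2` is empty:** `N² = 2M⁴ − 2940M²e² + 1097600e⁴` — 2-adic chain of depth `2⁸`.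
[folklore] -/
theorem W5p_kill_2 {M e N : ℤ} (hcop : Int.gcd M e = 1)
    (h : N ^ 2 = 2 * M ^ 4 - 2940 * M ^ 2 * e ^ 2 + 1097600 * e ^ 4) : False := by
  have k1 : ∀ m f n : ZMod 8, n ^ 2 = 2 * m ^ 4 - 2940 * m ^ 2 * f ^ 2 + 1097600 * f ^ 4 →
      (4 : ZMod 8) * m = 0 := by decide
  have h1 := intCast_sq_eq (m := 8) h
  push_cast at h1
  obtain ⟨M₁, rfl⟩ := two_dvd_of_zmod8 (k1 _ _ _ h1)
  have he : ¬ (2 : ℤ) ∣ e := fun he =>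
    false_of_dvd_of_dvd_of_gcd_eq_one (d := 2) (by norm_num) (dvd_mul_right 2 M₁) he hcop
  obtain ⟨N₁, rfl⟩ := four_dvd_of_sixteen_dvd_sq (N := N)
    ⟨2 * M₁ ^ 4 - 735 * M₁ ^ 2 * e ^ 2 + 68600 * e ^ 4, by linear_combination h⟩
  have h2 : N₁ ^ 2 = 2 * M₁ ^ 4 - 735 * M₁ ^ 2 * e ^ 2 + 68600 * e ^ 4 := by
    have h16 : (16 : ℤ) * N₁ ^ 2 = 16 * (2 * M₁ ^ 4 - 735 * M₁ ^ 2 * e ^ 2 + 68600 * e ^ 4) := by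
      linear_combination h
    exact mul_left_cancel₀ (by norm_num : (16 : ℤ) ≠ 0) h16
  have k3 : ∀ m f n : ZMod 8, n ^ 2 = 2 * m ^ 4 - 735 * m ^ 2 * f ^ 2 + 68600 * f ^ 4 →
      (4 : ZMod 8) * m = 0 ∨ (4 : ZMod 8) * f = 0 := by decide
  have h3 := intCast_sq_eq (m := 8) h2
  push_cast at h3
  obtain ⟨M₂, rfl⟩ := two_dvd_of_zmod8 ((k3 _ _ _ h3).resolve_right (zmod8_ne_of_not_two_dvd he))
  have h4 : N₁ ^ 2 = 32 * M₂ ^ 4 - 2940 * M₂ ^ 2 * e ^ 2 + 68600 * e ^ 4 := by linear_combination h2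
  have k4 : ∀ m f : ZMod 32, (16 : ZMod 32) * m ≠ 0 → (16 : ZMod 32) * f ≠ 0 →
      32 * m ^ 4 - 2940 * m ^ 2 * f ^ 2 + 68600 * f ^ 4 = 28 := by decide
  have k4' : ∀ n : ZMod 32, n ^ 2 ≠ 28 := by decide
  have hM₂ : (2 : ℤ) ∣ M₂ := by
    by_contra hM₂
    have h5 := intCast_sq_eq (m := 32) h4
    push_cast at h5
    have hm : (16 : ZMod 32) * (M₂ : ZMod 32) ≠ 0 := fun h0 =>
      hM₂ ((zmod_mul_intCast_eq_zero_iff (m := 32) (k := 16) (d := 2) rfl (by norm_num) M₂).mp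
        (by exact_mod_cast h0))
    have hf : (16 : ZMod 32) * (e : ZMod 32) ≠ 0 := fun h0 =>
      he ((zmod_mul_intCast_eq_zero_iff (m := 32) (k := 16) (d := 2) rfl (by norm_num) e).mp
        (by exact_mod_cast h0))
    rw [k4 _ _ hm hf] at h5
    exact k4' _ h5
  obtain ⟨M₃, rfl⟩ := hM₂
  have h6 : N₁ ^ 2 = 512 * M₃ ^ 4 - 11760 * M₃ ^ 2 * e ^ 2 + 68600 * e ^ 4 := by linear_combination h4
  have k6 : ∀ m f n : ZMod 16, n ^ 2 = 512 * m ^ 4 - 11760 * m ^ 2 * f ^ 2 + 68600 * f ^ 4 →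
      (8 : ZMod 16) * f = 0 := by decide
  have h7 := intCast_sq_eq (m := 16) h6
  push_cast at h7
  exact he (two_dvd_of_zmod16 (k6 _ _ _ h7))

/-- **`W⁵'`, class `14` is empty:** `N² = 14M⁴ − 2940M²e² + 156800e⁴` — the same 2-adic chain
(`≡ 12 mod 32` at step 4). [folklore] -/
theorem W5p_kill_14 {M e N : ℤ} (hcop : Int.gcd M e = 1)
    (h : N ^ 2 = 14 * M ^ 4 - 2940 * M ^ 2 * e ^ 2 + 156800 * e ^ 4) : False := by
  have k1 : ∀ m f n : ZMod 8, n ^ 2 = 14 * m ^ 4 - 2940 * m ^ 2 * f ^ 2 + 156800 * f ^ 4 →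
      (4 : ZMod 8) * m = 0 := by decide
  have h1 := intCast_sq_eq (m := 8) h
  push_cast at h1
  obtain ⟨M₁, rfl⟩ := two_dvd_of_zmod8 (k1 _ _ _ h1)
  have he : ¬ (2 : ℤ) ∣ e := fun he =>
    false_of_dvd_of_dvd_of_gcd_eq_one (d := 2) (by norm_num) (dvd_mul_right 2 M₁) he hcop
  obtain ⟨N₁, rfl⟩ := four_dvd_of_sixteen_dvd_sq (N := N)
    ⟨14 * M₁ ^ 4 - 735 * M₁ ^ 2 * e ^ 2 + 9800 * e ^ 4, by linear_combination h⟩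
  have h2 : N₁ ^ 2 = 14 * M₁ ^ 4 - 735 * M₁ ^ 2 * e ^ 2 + 9800 * e ^ 4 := by
    have h16 : (16 : ℤ) * N₁ ^ 2 = 16 * (14 * M₁ ^ 4 - 735 * M₁ ^ 2 * e ^ 2 + 9800 * e ^ 4) := by
      linear_combination h
    exact mul_left_cancel₀ (by norm_num : (16 : ℤ) ≠ 0) h16
  have k3 : ∀ m f n : ZMod 8, n ^ 2 = 14 * m ^ 4 - 735 * m ^ 2 * f ^ 2 + 9800 * f ^ 4 →
      (4 : ZMod 8) * m = 0 ∨ (4 : ZMod 8) * f = 0 := by decide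
  have h3 := intCast_sq_eq (m := 8) h2
  push_cast at h3
  obtain ⟨M₂, rfl⟩ := two_dvd_of_zmod8 ((k3 _ _ _ h3).resolve_right (zmod8_ne_of_not_two_dvd he))
  have h4 : N₁ ^ 2 = 224 * M₂ ^ 4 - 2940 * M₂ ^ 2 * e ^ 2 + 9800 * e ^ 4 := by linear_combination h2
  have k4 : ∀ m f : ZMod 32, (16 : ZMod 32) * m ≠ 0 → (16 : ZMod 32) * f ≠ 0 →
      224 * m ^ 4 - 2940 * m ^ 2 * f ^ 2 + 9800 * f ^ 4 = 12 := by decide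
  have k4' : ∀ n : ZMod 32, n ^ 2 ≠ 12 := by decide
  have hM₂ : (2 : ℤ) ∣ M₂ := by
    by_contra hM₂
    have h5 := intCast_sq_eq (m := 32) h4
    push_cast at h5
    have hm : (16 : ZMod 32) * (M₂ : ZMod 32) ≠ 0 := fun h0 =>
      hM₂ ((zmod_mul_intCast_eq_zero_iff (m := 32) (k := 16) (d := 2) rfl (by norm_num) M₂).mp
        (by exact_mod_cast h0))
    have hf : (16 : ZMod 32) * (e : ZMod 32) ≠ 0 := fun h0 =>
      he ((zmod_mul_intCast_eq_zero_iff (m := 32) (k := 16) (d := 2) rfl (by norm_num) e).mp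
        (by exact_mod_cast h0))
    rw [k4 _ _ hm hf] at h5
    exact k4' _ h5
  obtain ⟨M₃, rfl⟩ := hM₂
  have h6 : N₁ ^ 2 = 3584 * M₃ ^ 4 - 11760 * M₃ ^ 2 * e ^ 2 + 9800 * e ^ 4 := by linear_combination h4
  have k6 : ∀ m f n : ZMod 16, n ^ 2 = 3584 * m ^ 4 - 11760 * m ^ 2 * f ^ 2 + 9800 * f ^ 4 →
      (8 : ZMod 16) * f = 0 := by decide
  have h7 := intCast_sq_eq (m := 16) h6
  push_cast at h7
  exact he (two_dvd_of_zmod16 (k6 _ _ _ h7))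

end Kills

/-! ### §2 Normalisation: square or translated square -/

/-- **`W⁵`: every affine point with `x ≠ 0` has `x = r²` or `−8575/x = r²` (`r ≠ 0`).**  By the
class lemma `x = d·s²/e²`, `|d| ∣ 8575 = 5²7³`, `|d| = 5ʲ7ᵏ = d₀·c²` with `d₀ ∈ {1, 5, 7, 35}` and a
sign; of the eight signed classes only `+1` (square) and `−7` (translate of a square,
`−8575/x = (35e/(cs))²`) survive §1 (applied to the coprime pair `(c·s, e)`). [folklore] -/
theorem W5_sq_or_transl_sq {x y : ℚ} (hx : x ≠ 0) (hy : y ^ 2 = x * (x ^ 2 + 1470 * x - 8575)) :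
    (∃ r : ℚ, r ≠ 0 ∧ x = r ^ 2) ∨ (∃ r : ℚ, r ≠ 0 ∧ -8575 / x = r ^ 2) := by
  have hy' : y ^ 2 = x * (x ^ 2 + ((1470 : ℤ) : ℚ) * x + ((-8575 : ℤ) : ℚ)) := by
    push_cast; linear_combination hy
  obtain ⟨d, b', s, N, e, hdb, he, hs, hse, hde, hxd, hN⟩ := descent_class hx hy'
  have hsQ : (s : ℚ) ≠ 0 := by exact_mod_cast hs
  have heQ : (e : ℚ) ≠ 0 := by exact_mod_cast he.ne'
  set D : ℕ := d.natAbs with hD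
  have hDdvd : D ∣ 5 ^ 2 * 7 ^ 3 := by
    refine ⟨b'.natAbs, ?_⟩
    have := congrArg Int.natAbs hdb
    rw [Int.natAbs_mul] at this
    simpa using this.symm
  have hsplit : D = Nat.gcd D (5 ^ 2) * Nat.gcd D (7 ^ 3) := by
    rw [← Nat.Coprime.gcd_mul D (by norm_num : Nat.Coprime (5 ^ 2) (7 ^ 3)), Nat.gcd_eq_left hDdvd]
  obtain ⟨j, hj, hDj⟩ := (Nat.dvd_prime_pow Nat.prime_five).mp (Nat.gcd_dvd_right D (5 ^ 2))
  obtain ⟨k, hk, hDk⟩ := (Nat.dvd_prime_pow Nat.prime_seven).mp (Nat.gcd_dvd_right D (7 ^ 3))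
  rw [hDj, hDk, pow_eq_pow_mod_two_mul_sq 5 j, pow_eq_pow_mod_two_mul_sq 7 k] at hsplit
  set c : ℕ := 5 ^ (j / 2) * 7 ^ (k / 2) with hc
  have hc0 : (c : ℚ) ≠ 0 := by positivity
  have hDc : D = 5 ^ (j % 2) * 7 ^ (k % 2) * c ^ 2 := by rw [hsplit, hc]; ring
  -- `gcd(c·s, e) = 1`
  have hcse : Int.gcd ((c : ℤ) * s) e = 1 := by
    have hcd : (c : ℤ) ∣ d := by
      have : (c : ℤ) ∣ (D : ℤ) := ⟨5 ^ (j % 2) * 7 ^ (k % 2) * c, by rw [hDc]; push_cast; ring⟩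
      exact this.trans (Int.natAbs_dvd.mpr (dvd_refl d))
    have hce : IsCoprime (c : ℤ) (e : ℤ) :=
      (Int.isCoprime_iff_gcd_eq_one.mpr hde).of_isCoprime_of_dvd_left hcd
    exact Int.isCoprime_iff_gcd_eq_one.mp (hce.mul_left (Int.isCoprime_iff_gcd_eq_one.mpr hse))
  -- the sign
  have hd_cases : d = (D : ℤ) ∨ d = -(D : ℤ) := by
    rcases Int.natAbs_eq d with h | h
    · exact Or.inl h
    · exact Or.inr h
  have hDQ : ((D : ℤ) : ℚ) = (5 : ℚ) ^ (j % 2) * 7 ^ (k % 2) * (c : ℚ) ^ 2 := by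
    rw [hDc]; push_cast; ring
  have hDZ : (D : ℤ) = (5 : ℤ) ^ (j % 2) * 7 ^ (k % 2) * (c : ℤ) ^ 2 := by
    rw [hDc]; push_cast; ring
  rcases hd_cases with hdD | hdD <;>
    rcases Nat.mod_two_eq_zero_or_one j with hj2 | hj2 <;>
    rcases Nat.mod_two_eq_zero_or_one k with hk2 | hk2 <;>
    simp only [hj2, hk2, pow_zero, pow_one, one_mul, mul_one] at hDQ hDZ <;>
    rw [hDZ] at hdD
  · -- `d = c²`: class 1
    left
    refine ⟨c * s / e, div_ne_zero (mul_ne_zero hc0 hsQ) heQ, ?_⟩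
    rw [hxd, hdD]; push_cast; ring
  · -- `d = 7c²`: class 7, empty
    exfalso
    have hcb : (c : ℤ) ^ 2 * b' = -1225 := by
      have h' := hdb; rw [hdD] at h'; linarith
    refine W5_kill_mod16 (Or.inr (Or.inl ⟨rfl, rfl⟩)) (M := c * s) (N := c * N) hcse ?_
    rw [hdD] at hN
    linear_combination (c : ℤ) ^ 2 * hN + (e : ℤ) ^ 4 * hcb
  · -- `d = 5c²`: class 5, empty
    exfalso
    have hcb : (c : ℤ) ^ 2 * b' = -1715 := by
      have h' := hdb; rw [hdD] at h'; linarith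
    refine W5_kill_5 (M := c * s) (N := c * N) hcse ?_
    rw [hdD] at hN
    linear_combination (c : ℤ) ^ 2 * hN + (e : ℤ) ^ 4 * hcb
  · -- `d = 35c²`: class 35, empty
    exfalso
    have hcb : (c : ℤ) ^ 2 * b' = -245 := by
      have h' := hdb; rw [hdD] at h'; linarith
    refine W5_kill_mod16 (Or.inr (Or.inr (Or.inr ⟨rfl, rfl⟩))) (M := c * s) (N := c * N) hcse ?_
    rw [hdD] at hN
    linear_combination (c : ℤ) ^ 2 * hN + (e : ℤ) ^ 4 * hcb
  · -- `d = −c²`: class −1, empty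
    exfalso
    have hcb : (c : ℤ) ^ 2 * b' = 8575 := by
      have h' := hdb; rw [hdD] at h'; linarith
    refine W5_kill_mod16 (Or.inl ⟨rfl, rfl⟩) (M := c * s) (N := c * N) hcse ?_
    rw [hdD] at hN
    linear_combination (c : ℤ) ^ 2 * hN + (e : ℤ) ^ 4 * hcb
  · -- `d = −7c²`: class of `T`, translate is a square
    right
    refine ⟨35 * e / (c * s), div_ne_zero (mul_ne_zero (by norm_num) heQ) (mul_ne_zero hc0 hsQ), ?_⟩
    rw [hxd, hdD]; push_cast; field_simp; ring
  · -- `d = −5c²`: class −5, empty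
    exfalso
    have hcb : (c : ℤ) ^ 2 * b' = 1715 := by
      have h' := hdb; rw [hdD] at h'; linarith
    refine W5_kill_mod16 (Or.inr (Or.inr (Or.inl ⟨rfl, rfl⟩))) (M := c * s) (N := c * N) hcse ?_
    rw [hdD] at hN
    linear_combination (c : ℤ) ^ 2 * hN + (e : ℤ) ^ 4 * hcb
  · -- `d = −35c²`: class −35, empty
    exfalso
    have hcb : (c : ℤ) ^ 2 * b' = 245 := by
      have h' := hdb; rw [hdD] at h'; linarith
    refine W5_kill_neg35 (M := c * s) (N := c * N) hcse ?_
    rw [hdD] at hN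
    linear_combination (c : ℤ) ^ 2 * hN + (e : ℤ) ^ 4 * hcb

/-- **`W⁵'`: every affine point with `X ≠ 0` has `X = R²` or `2195200/X = R²` (`R ≠ 0`).**
`X > 0` (`X² − 2940X + 2195200 = (X − 1470)² + 34300`); `X = d·s²/e²`, `0 < d ∣ 2195200 = 2⁸5²7³`,
`d = d₀·c²`, `d₀ ∈ {1,2,5,7,10,14,35,70}`; only `1` (square) and `7` (`2195200/X = (560e/(cs))²`)
survive §1. [folklore] -/
theorem W5p_sq_or_transl_sq {X Y : ℚ} (hX : X ≠ 0) (hY : Y ^ 2 = X * (X ^ 2 - 2940 * X + 2195200)) :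
    (∃ R : ℚ, R ≠ 0 ∧ X = R ^ 2) ∨ (∃ R : ℚ, R ≠ 0 ∧ 2195200 / X = R ^ 2) := by
  have hY' : Y ^ 2 = X * (X ^ 2 + ((-2940 : ℤ) : ℚ) * X + ((2195200 : ℤ) : ℚ)) := by
    push_cast; linear_combination hY
  have hpos : 0 < X := descent_pos_of_onCurve hX hY' (by push_cast; nlinarith [sq_nonneg (X - 1470)])
  obtain ⟨d, b', s, N, e, hdb, he, hs, hse, hde, hxd, hN⟩ := descent_class hX hY'
  have hsQ : (s : ℚ) ≠ 0 := by exact_mod_cast hs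
  have heQ : (e : ℚ) ≠ 0 := by exact_mod_cast he.ne'
  have hd0 : 0 < d := by
    have h1 : (0 : ℚ) < (d : ℚ) * ((s : ℚ) ^ 2 / (e : ℚ) ^ 2) := by
      rw [← mul_div_assoc, ← hxd]; exact hpos
    have h2 : (0 : ℚ) < (s : ℚ) ^ 2 / (e : ℚ) ^ 2 := by positivity
    have : (0 : ℚ) < d := (pos_iff_pos_of_mul_pos h1).mpr h2
    exact_mod_cast this
  set D : ℕ := d.natAbs with hD
  have hDd : (D : ℤ) = d := Int.natAbs_of_nonneg hd0.le
  have hDdvd : D ∣ 2 ^ 8 * 5 ^ 2 * 7 ^ 3 := by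
    refine ⟨b'.natAbs, ?_⟩
    have := congrArg Int.natAbs hdb
    rw [Int.natAbs_mul] at this
    simpa using this.symm
  have hsplit : D = Nat.gcd D (2 ^ 8) * Nat.gcd D (5 ^ 2) * Nat.gcd D (7 ^ 3) := by
    rw [← Nat.Coprime.gcd_mul D (by norm_num : Nat.Coprime (2 ^ 8) (5 ^ 2)),
      ← Nat.Coprime.gcd_mul D (by norm_num : Nat.Coprime (2 ^ 8 * 5 ^ 2) (7 ^ 3)), Nat.gcd_eq_left hDdvd]
  obtain ⟨i, hi, hDi⟩ := (Nat.dvd_prime_pow Nat.prime_two).mp (Nat.gcd_dvd_right D (2 ^ 8))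
  obtain ⟨j, hj, hDj⟩ := (Nat.dvd_prime_pow Nat.prime_five).mp (Nat.gcd_dvd_right D (5 ^ 2))
  obtain ⟨k, hk, hDk⟩ := (Nat.dvd_prime_pow Nat.prime_seven).mp (Nat.gcd_dvd_right D (7 ^ 3))
  rw [hDi, hDj, hDk, pow_eq_pow_mod_two_mul_sq 2 i, pow_eq_pow_mod_two_mul_sq 5 j,
    pow_eq_pow_mod_two_mul_sq 7 k] at hsplit
  set c : ℕ := 2 ^ (i / 2) * 5 ^ (j / 2) * 7 ^ (k / 2) with hc
  have hc0 : (c : ℚ) ≠ 0 := by positivity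
  have hDc : D = 2 ^ (i % 2) * 5 ^ (j % 2) * 7 ^ (k % 2) * c ^ 2 := by rw [hsplit, hc]; ring
  have hcse : Int.gcd ((c : ℤ) * s) e = 1 := by
    have hcd : (c : ℤ) ∣ d := ⟨2 ^ (i % 2) * 5 ^ (j % 2) * 7 ^ (k % 2) * c, by rw [← hDd, hDc]; push_cast; ring⟩
    have hce : IsCoprime (c : ℤ) (e : ℤ) :=
      (Int.isCoprime_iff_gcd_eq_one.mpr hde).of_isCoprime_of_dvd_left hcd
    exact Int.isCoprime_iff_gcd_eq_one.mp (hce.mul_left (Int.isCoprime_iff_gcd_eq_one.mpr hse))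
  have hdQ : (d : ℚ) = (2 : ℚ) ^ (i % 2) * 5 ^ (j % 2) * 7 ^ (k % 2) * (c : ℚ) ^ 2 := by
    rw [← hDd, hDc]; push_cast; ring
  have hdZ : d = (2 : ℤ) ^ (i % 2) * 5 ^ (j % 2) * 7 ^ (k % 2) * (c : ℤ) ^ 2 := by
    rw [← hDd, hDc]; push_cast; ring
  rcases Nat.mod_two_eq_zero_or_one i with hi2 | hi2 <;>
    rcases Nat.mod_two_eq_zero_or_one j with hj2 | hj2 <;>
    rcases Nat.mod_two_eq_zero_or_one k with hk2 | hk2 <;>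
    simp only [hi2, hj2, hk2, pow_zero, pow_one, one_mul, mul_one] at hdQ hdZ
  · -- `d₀ = 1`
    left
    exact ⟨c * s / e, div_ne_zero (mul_ne_zero hc0 hsQ) heQ, by rw [hxd, hdQ]; ring⟩
  · -- `d₀ = 7`
    right
    refine ⟨560 * e / (c * s), div_ne_zero (mul_ne_zero (by norm_num) heQ) (mul_ne_zero hc0 hsQ), ?_⟩
    rw [hxd, hdQ]; field_simp; ring
  · -- `d₀ = 5`
    exfalso
    have hcb : (c : ℤ) ^ 2 * b' = 439040 := by
      have h' := hdb; rw [hdZ] at h'; linarith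
    refine W5p_kill_five (Or.inl ⟨rfl, rfl⟩) (M := c * s) (N := c * N) hcse ?_
    rw [hdZ] at hN
    linear_combination (c : ℤ) ^ 2 * hN + (e : ℤ) ^ 4 * hcb
  · -- `d₀ = 35`
    exfalso
    have hcb : (c : ℤ) ^ 2 * b' = 62720 := by
      have h' := hdb; rw [hdZ] at h'; linarith
    refine W5p_kill_five (Or.inr (Or.inr (Or.inl ⟨rfl, rfl⟩))) (M := c * s) (N := c * N) hcse ?_
    rw [hdZ] at hN
    linear_combination (c : ℤ) ^ 2 * hN + (e : ℤ) ^ 4 * hcb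
  · -- `d₀ = 2`
    exfalso
    have hcb : (c : ℤ) ^ 2 * b' = 1097600 := by
      have h' := hdb; rw [hdZ] at h'; linarith
    refine W5p_kill_2 (M := c * s) (N := c * N) hcse ?_
    rw [hdZ] at hN
    linear_combination (c : ℤ) ^ 2 * hN + (e : ℤ) ^ 4 * hcb
  · -- `d₀ = 14`
    exfalso
    have hcb : (c : ℤ) ^ 2 * b' = 156800 := by
      have h' := hdb; rw [hdZ] at h'; linarith
    refine W5p_kill_14 (M := c * s) (N := c * N) hcse ?_
    rw [hdZ] at hN
    linear_combination (c : ℤ) ^ 2 * hN + (e : ℤ) ^ 4 * hcb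
  · -- `d₀ = 10`
    exfalso
    have hcb : (c : ℤ) ^ 2 * b' = 219520 := by
      have h' := hdb; rw [hdZ] at h'; linarith
    refine W5p_kill_five (Or.inr (Or.inl ⟨rfl, rfl⟩)) (M := c * s) (N := c * N) hcse ?_
    rw [hdZ] at hN
    linear_combination (c : ℤ) ^ 2 * hN + (e : ℤ) ^ 4 * hcb
  · -- `d₀ = 70`
    exfalso
    have hcb : (c : ℤ) ^ 2 * b' = 31360 := by
      have h' := hdb; rw [hdZ] at h'; linarith
    refine W5p_kill_five (Or.inr (Or.inr (Or.inr ⟨rfl, rfl⟩))) (M := c * s) (N := c * N) hcse ?_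
    rw [hdZ] at hN
    linear_combination (c : ℤ) ^ 2 * hN + (e : ℤ) ^ 4 * hcb

end Summit.Langlands.Langlands.Theorems.SqrtFiveQuarticCovers
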